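import Summits.HodgeConjecture.HodgeConjecture.Cruxes.SectorComplement.IdeatorTwoSketch

/-!
# Crux-plan `deep-cycle-shadows` for crux `SectorComplement` (stmt-HodgeConjecture-14353) — verdict NO-SKELETON; checked residue

Planner `planner-cruxplan-stmt-HodgeConjecture-14353-deep-cycle-shadows-0`, 2026-08-16.
Crux (route `EndoscopicMiddleDegree`, rank-9 SECTOR FRAME, auto-cruxed):
`SectorComplement : Prop := MiddleDegreeStep → _root_.HodgeConjecture`.

## Verdict: no concluding skeleton exists (this file is the kernel-checked reason and the harvest)

`Disproof.hodgeConjecture_iff : HodgeConjecture ↔ MiddleDegreeStep ∧ SectorComplement` (the disprover's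
file is a living document and is deliberately NOT imported; the identity is re-proved in §4 as
`frame_is_summit_off_sector`): the crux IS the summit off the sector. The idea `deep-cycle-shadows` treats ONE
family of cells of the complement — the lower band `(p, k) = (2k+3, k+1)` of compact simple-type
ball quotients: `(5,2)`, `(7,3)`. A composition `stub₁ → … → stub_k → SectorComplement` therefore
needs, on top of everything the idea can supply, the stub `Residual` of §4 — and §4 proves
`Residual ↔ SectorComplement` GIVEN the line's own output: the residual stub is the crux again
(COSTUME by construction; all three triagers said so, TRIAGE-r1-1/2/3). Hence no-skeleton.

## What is checked here and handed on (all `sorry`-free; nothing is proposed to the gate)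

* §1 the two lower-band cells `FiveBallCodimTwo`, `SevenBallCodimThree` (sub-statements of HC).
* §2 the ONE new stub the idea reduces them to, with the triagers' loophole closed: no
  `∃ R : SpecialLefschetzRing` any more. Pinning `R := algebraicClasses` (the only pinning for which
  the sector delivers the partner statement, see §5 for the other one) the card's `DeepShallow`
  becomes `LDivision k` — "h-division preserves algebraicity for rational Hodge classes one step
  below the middle of a datum-`(2k+3)` variety" — the Hodge-class form of Grothendieck's standard
  conjecture of Lefschetz type `A(X, h)` in the degree pair `(2k+2, 2k+4)` (`StandardAStep k`, the
  Hodge-free form; `lDivision_of_standardAStep`). It is implied by the cell (`lDivision_one_of_cell`)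
  — honest: at cell level the residual is cell-EQUIVALENT given the free stubs, exactly as
  triage r1-1 (iv) predicted; the transfer "HC(5,2) ⟺ A-step" is a reformulation, not a shrink.
* §3 the composition, REUSING VERBATIM the stubs of the merged staircase/funnel line
  (`IdeatorTwo.KMZero`, `IdeatorTwo.SpecialDivisorBridge`, binders `LefschetzOneOneOnFourBalls`,
  `BMMSixTwo`, graded commutativity): `lowerBandCells_holds :
  MiddleDegreeStep → … → LDivision 1 → LDivision 2 → FiveBallCodimTwo ∧ SevenBallCodimThree`
  — the crux hypothesis `MiddleDegreeStep` is USED (at the partner step: `ν^* α` sits in the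
  MIDDLE degree of the special divisors), and `fiveBallHodge_holds`: with Lefschetz (1,1) on
  datum-5 varieties and Hodge models, HC for compact arithmetic 5-ball quotients in ALL degrees
  ⟸ sector (m = 1) ∧ KM₀ ∧ bridge ∧ `LDivision 1` (the analogue of the route's `FourfoldHodge`).
* §4 the frame certificate (`Residual`, `residual_iff_sectorComplement`).
* §5 the card's finer, Hodge-free content with the ring PINNED to the theta span
  (`thetaSpanTwo/Three`, `DeepShallowFive`, `PartnerInThetaFive`, `HigherBRFive`): the ring version
  of the line does NOT consume `MiddleDegreeStep` at all (`fiveBallCodimTwo_of_theta`) and dies at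
  `PartnerInThetaFive` (= `MiddleThetaSpan` on every special divisor, which route rev 7 EXPECTS
  FALSE: ε-negative CAP classes); what survives is the checkable two-sided bet for crux
  stmt-13662: `higherBRFive_of_not_shallow` — a deep rational `(3,3)` theta class not divisible by
  `h` inside the theta span hands 13662 the NAMED class `h⁻¹ y`.
-/

noncomputable section

set_option linter.dupNamespace false

namespace Summit.HodgeConjecture.HodgeConjecture.Cruxes.SectorComplement.DeepCycleShadows

open Literature.AlgebraicGeometry.Motives (SchemeOver ComplexPoints IsSmoothProjective)
open Literature.AlgebraicGeometry.HodgeTheory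
open Literature.AlgebraicGeometry.ShimuraVarieties
open Literature.AlgebraicTopology.SingularHomology (cupProduct cupProduct_gradedComm)
open Summit.HodgeConjecture.HodgeConjecture.Theses.EndoscopicMiddleDegree
  (MiddleDegreeStep SectorComplement)
open Summit.HodgeConjecture.HodgeConjecture.Cruxes.SectorComplement.IdeatorTwo
  (KMZero SpecialDivisorBridge LefschetzOneOneOnFourBalls BMMSixTwo FiveBallCodimThree
    cup_hyperplane_mem L_one_eq_cup)

/-! ## §1 The lower-band cells `(2k+3, k+1)` of the complement -/

/-- Cell `(5,2)`: HC in codimension 2 on compact arithmetic 5-ball quotients of simple unitary type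
(`2 ∈ ]5/3, 10/3[` is excluded by BMM Cor. 2; the home of the dropped route item
`HigherBlasiusRogawskiClass`, stmt-HodgeConjecture-13662). -/
def FiveBallCodimTwo : Prop :=
  ∀ (X : SchemeOver ℂ), Nonempty (UnitaryBallQuotientDatum 5 X) →
    ∀ c : complexBetti X (2 * 2), IsRationalClass c → IsOfHodgeType 5 X (2 * 2) 2 2 c →
      c ∈ algebraicClasses X 2

/-- Cell `(7,3)`: HC in codimension 3 on compact arithmetic 7-ball quotients (`3 ∈ ]7/3, 14/3[`). -/
def SevenBallCodimThree : Prop :=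
  ∀ (X : SchemeOver ℂ), Nonempty (UnitaryBallQuotientDatum 7 X) →
    ∀ c : complexBetti X (2 * 3), IsRationalClass c → IsOfHodgeType 7 X (2 * 3) 3 3 c →
      c ∈ algebraicClasses X 3

/-- Cells are sub-statements of the summit (so nothing below is refutable short of `¬HC`,
cf. the disprover's `Disproof.not_hodgeConjecture_of_not_sectorComplement`). -/
theorem fiveBallCodimTwo_of_hodge (h : _root_.HodgeConjecture) : FiveBallCodimTwo := by
  rintro X ⟨D⟩ c hc hH
  exact (h D.isSmoothProjective).2 2 c hc hH

theorem sevenBallCodimThree_of_hodge (h : _root_.HodgeConjecture) : SevenBallCodimThree := by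
  rintro X ⟨D⟩ c hc hH
  exact (h D.isSmoothProjective).2 3 c hc hH

/-! ## §2 The one new stub: `h`-division one step below the middle

With `R := algebraicClasses` the card's `DeepShallow R` reads: for `x ∈ H^{2k+2}(X^{2k+3})` with
`x ∪ h` algebraic, `x` is algebraic. For RATIONAL HODGE `x` this is `LDivision`; for all algebraic
`x ∪ h` it is one step of Grothendieck's standard conjecture `A(X, h)` (`StandardAStep`). -/

/-- STANDARD CONJECTURE `A(X, h)`, ONE STEP BELOW THE MIDDLE (Hodge-free form): on a datum-`(2k+3)`
variety every algebraic class of codimension `k+2` is `h ∪` (an algebraic class of codimension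
`k+1`), `h` the hyperplane class of ANY hard-Lefschetz datum. Grothendieck 1969 (standard
conjectures), Kleiman 1968/1994: known for curves, surfaces, abelian varieties, generalized flag
varieties, uniruled threefolds and a few special classes (Arapura 2006, Charles–Markman 2013), stable
under products; open in general from dimension 3 on, in particular for every compact ball quotient of
dimension ≥ 3; implied by HC(X). -/
def StandardAStep (k : ℕ) : Prop :=
  ∀ (S : SchemeOver ℂ), Nonempty (UnitaryBallQuotientDatum (2 * k + 3) S) →
    ∀ Λ : HardLefschetzNFold (2 * k + 3) S,
      algebraicClasses S (k + 2) ≤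
        (algebraicClasses S (k + 1)).map (Λ.L 1 (2 * (k + 1)) (2 * (k + 2)) (by omega))

/-- `h`-DIVISION FOR RATIONAL HODGE CLASSES (the form the composition uses): on a datum-`(2k+3)`
variety, a rational Hodge `(k+1,k+1)`-class whose image under `L = h ∪ ·` is algebraic is algebraic.
This is the card's `DeepShallow` with the ring pinned to `algebraicClasses`. -/
def LDivision (k : ℕ) : Prop :=
  ∀ (S : SchemeOver ℂ), Nonempty (UnitaryBallQuotientDatum (2 * k + 3) S) →
    ∀ (Λ : HardLefschetzNFold (2 * k + 3) S) (x : complexBetti S (2 * (k + 1))),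
      IsRationalClass x → IsOfHodgeType (2 * k + 3) S (2 * (k + 1)) (k + 1) (k + 1) x →
      Λ.L 1 (2 * (k + 1)) (2 * (k + 2)) (by omega) x ∈ algebraicClasses S (k + 2) →
      x ∈ algebraicClasses S (k + 1)

/-- The Hodge-free stub implies the one used (hard Lefschetz: `L` is injective on `H^{2k+2}` of a
`(2k+3)`-fold, `(2k+2) + 1 = 2k+3`). -/
theorem lDivision_of_standardAStep {k : ℕ} (h : StandardAStep k) : LDivision k := by
  intro S hD Λ x _ _ hx
  obtain ⟨x', hx', hxx'⟩ := Submodule.mem_map.1 (h S hD Λ hx)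
  have hinj := (Λ.bijective_L (j := 1) (k := 2 * (k + 1)) (by omega) (2 * (k + 2)) (by omega)).1
  exact hinj hxx' ▸ hx'

/-- Honesty check (triage r1-1 (iv)): the stub is implied by the cell it serves — at cell level the
residual is cell-EQUIVALENT given the free stubs. -/
theorem lDivision_one_of_cell (h : FiveBallCodimTwo) : LDivision 1 :=
  fun S hD _ x hx hxt _ ↦ h S hD x hx hxt

theorem lDivision_two_of_cell (h : SevenBallCodimThree) : LDivision 2 :=
  fun S hD _ x hx hxt _ ↦ h S hD x hx hxt

/-! ## §3 The composition: lower band ⟸ sector ∧ KM₀ ∧ bridge ∧ h-division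

Stubs shared VERBATIM with the merged staircase/funnel line (`IdeatorTwo.KMZero`: a hard-Lefschetz
datum whose hyperplane class is a sum of classes supported on special divisors — Kudla–Millson;
`IdeatorTwo.SpecialDivisorBridge`: `c ∪ d` algebraic for `d` supported on a special divisor once HC
holds in degree `2k` on datum-`p` varieties — projection formula `ν_*(ν^* c) = c ∪ [Z]` plus the
normalised special divisor as a datum-`p` variety). The partner of a LOWER-band class `c` of
`X^{2k+3}` is `ν^* c` in the MIDDLE degree `2k+2` of the `(2k+2)`-ball divisors: the sector. -/

/-- **Cell (5,2) from the sector.** `MiddleDegreeStep` at m = 1 (with its binder Lefschetz (1,1)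
on 4-ball quotients), KM₀, the bridge, graded commutativity of `∪`, and `h`-division give HC in
codimension 2 on compact arithmetic 5-ball quotients: for a rational Hodge `(2,2)`-class `c`,
`c ∪ h = Σ ν_{i*}(ν_i^* c)` is algebraic because `ν_i^* c` sits in the MIDDLE degree of the 4-ball
divisors (the sector), and `h`-division returns `c`. -/
theorem fiveBallCodimTwo_holds :
    MiddleDegreeStep → LefschetzOneOneOnFourBalls → KMZero → SpecialDivisorBridge →
      (∀ S : SchemeOver ℂ, cupProduct_gradedComm ℂ (ComplexPoints S)) →
      LDivision 1 → FiveBallCodimTwo := by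
  intro hstep hL11 hKM hbridge hcomm hdiv S hD c hc hct
  -- the sector's conclusion: HC in the middle degree of datum-4 varieties
  have A44 : ∀ (Z : SchemeOver ℂ), Nonempty (UnitaryBallQuotientDatum 4 Z) →
      ∀ z : complexBetti Z (2 * 2), IsRationalClass z → IsOfHodgeType 4 Z (2 * 2) 2 2 z →
        z ∈ algebraicClasses Z 2 :=
    fun Z hZ z hz hzt ↦ hstep 1 Z le_rfl (by norm_num) hZ (hL11 Z hZ) z hz hzt
  obtain ⟨D⟩ := hD
  obtain ⟨Λ, n, W, d, hd, hsum⟩ := hKM 4 S D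
  refine hdiv S ⟨D⟩ Λ c hc hct ?_
  show Λ.L 1 (2 * 2) (2 * 3) (by norm_num) c ∈ algebraicClasses S 3
  rw [L_one_eq_cup (hcomm S) Λ c]
  exact cup_hyperplane_mem hbridge D A44 Λ W d hd hsum c hc hct

/-- **Cell (7,3) from the sector.** Same mechanism one storey up: the special divisors of a 7-ball
quotient are 6-ball quotients, whose middle degree 6 is `MiddleDegreeStep` at m = 2 (binder: BMM
Cor. 2 at `(6,2)`, conditional in print on the twisted weighted fundamental lemma). -/
theorem sevenBallCodimThree_holds :
    MiddleDegreeStep → BMMSixTwo → KMZero → SpecialDivisorBridge →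
      (∀ S : SchemeOver ℂ, cupProduct_gradedComm ℂ (ComplexPoints S)) →
      LDivision 2 → SevenBallCodimThree := by
  intro hstep hbmm hKM hbridge hcomm hdiv S hD c hc hct
  have A66 : ∀ (Z : SchemeOver ℂ), Nonempty (UnitaryBallQuotientDatum 6 Z) →
      ∀ z : complexBetti Z (2 * 3), IsRationalClass z → IsOfHodgeType 6 Z (2 * 3) 3 3 z →
        z ∈ algebraicClasses Z 3 :=
    fun Z hZ z hz hzt ↦ hstep 2 Z (by norm_num) le_rfl hZ (hbmm Z hZ) z hz hzt
  obtain ⟨D⟩ := hD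
  obtain ⟨Λ, n, W, d, hd, hsum⟩ := hKM 6 S D
  refine hdiv S ⟨D⟩ Λ c hc hct ?_
  show Λ.L 1 (2 * 3) (2 * 4) (by norm_num) c ∈ algebraicClasses S 4
  rw [L_one_eq_cup (hcomm S) Λ c]
  exact cup_hyperplane_mem hbridge D A66 Λ W d hd hsum c hc hct

/-- **The lower band from the sector** (both cells; the would-be `SectorComplement_of` minus its
costume residual, §4). -/
theorem lowerBandCells_holds :
    MiddleDegreeStep → LefschetzOneOneOnFourBalls → BMMSixTwo → KMZero → SpecialDivisorBridge →
      (∀ S : SchemeOver ℂ, cupProduct_gradedComm ℂ (ComplexPoints S)) →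
      LDivision 1 → LDivision 2 → FiveBallCodimTwo ∧ SevenBallCodimThree :=
  fun hstep hL11 hbmm hKM hbridge hcomm hdiv1 hdiv2 ↦
    ⟨fiveBallCodimTwo_holds hstep hL11 hKM hbridge hcomm hdiv1,
      sevenBallCodimThree_holds hstep hbmm hKM hbridge hcomm hdiv2⟩

/-- **Lower cell from the upper cell** (the factorisation triage G2-3 asked for): on a 5-ball
quotient with a hard-Lefschetz datum, HC in codimension 3 (the STAIRCASE line's cell `(5,3)`,
`IdeatorTwo.FiveBallCodimThree`) and `h`-division give HC in codimension 2 — `L c` is rational of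
type `(3,3)`, hence algebraic, and `h`-division returns `c`. So relative to the merged
staircase/funnel line this idea contributes exactly ONE stub per cell, `LDivision k`. -/
theorem fiveBallCodimTwo_of_codimThree
    (hΛ : ∀ (X : SchemeOver ℂ), Nonempty (UnitaryBallQuotientDatum 5 X) →
      Nonempty (HardLefschetzNFold 5 X))
    (h53 : FiveBallCodimThree) (hdiv : LDivision 1) : FiveBallCodimTwo := by
  intro X hD c hc hct
  obtain ⟨Λ⟩ := hΛ X hD
  refine hdiv X hD Λ c hc hct ?_
  show Λ.L 1 (2 * 2) (2 * 3) (by norm_num) c ∈ algebraicClasses X 3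
  exact h53 X hD _ (Λ.isRationalClass_L 1 (2 * 2) (2 * 3) (by norm_num) hc)
    (Λ.isOfHodgeType_L 1 (2 * 2) (2 * 3) (by norm_num) 2 2 hct)

/-- Same one storey up: `(7,3) ⟸ (7,4) ∧ LDivision 2` (`IdeatorTwo.SevenBallCodimFour` is the
staircase's cell, from the sector at m = 2 and BMM Cor. 2 at `(6,2)`). -/
theorem sevenBallCodimThree_of_codimFour
    (hΛ : ∀ (X : SchemeOver ℂ), Nonempty (UnitaryBallQuotientDatum 7 X) →
      Nonempty (HardLefschetzNFold 7 X))
    (h74 : IdeatorTwo.SevenBallCodimFour) (hdiv : LDivision 2) : SevenBallCodimThree := by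
  intro X hD c hc hct
  obtain ⟨Λ⟩ := hΛ X hD
  refine hdiv X hD Λ c hc hct ?_
  show Λ.L 1 (2 * 3) (2 * 4) (by norm_num) c ∈ algebraicClasses X 4
  exact h74 X hD _ (Λ.isRationalClass_L 1 (2 * 3) (2 * 4) (by norm_num) hc)
    (Λ.isOfHodgeType_L 1 (2 * 3) (2 * 4) (by norm_num) 3 3 hct)

/-- Lefschetz (1,1) on datum-5 varieties (a theorem; binder of the all-degrees pay-off). -/
def LefschetzOneOneOnFiveBalls : Prop :=
  ∀ (X : SchemeOver ℂ), Nonempty (UnitaryBallQuotientDatum 5 X) →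
    ∀ a : complexBetti X (2 * 1), IsRationalClass a → IsOfHodgeType 5 X (2 * 1) 1 1 a →
      a ∈ algebraicClasses X 1

/-- **HC for compact arithmetic 5-ball quotients in every degree** from the cell `(5,2)`, Lefschetz
(1,1), a hard-Lefschetz datum (degrees 6, 8, 10 from 4, 2, 0) and a Hodge model — the calibration
statement one dimension above the route's `FourfoldHodge`. -/
theorem fiveBall_allDegrees (h52 : FiveBallCodimTwo) (hL11 : LefschetzOneOneOnFiveBalls)
    (hΛ : ∀ (X : SchemeOver ℂ), Nonempty (UnitaryBallQuotientDatum 5 X) →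
      Nonempty (HardLefschetzNFold 5 X))
    (hA : ∀ (X : SchemeOver ℂ), Nonempty (UnitaryBallQuotientDatum 5 X) → Nonempty (HodgeModel 5 X)) :
    ∀ (X : SchemeOver ℂ), Nonempty (UnitaryBallQuotientDatum 5 X) → HodgeConjectureFor 5 X := by
  intro X hD
  have low : ∀ q, q ≤ 2 → ∀ c : complexBetti X (2 * q), IsRationalClass c →
      IsOfHodgeType 5 X (2 * q) q q c → c ∈ algebraicClasses X q := by
    intro q hq c hc hct
    rcases (by omega : q = 0 ∨ q = 1 ∨ q = 2) with rfl | rfl | rfl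
    · exact hodgeConjectureFor_codim_zero c
    · exact hL11 X hD c hc hct
    · exact h52 X hD c hc hct
  refine ⟨hA X hD, fun p c hc hct ↦ ?_⟩
  by_cases hp : p ≤ 2
  · exact low p hp c hc hct
  · obtain ⟨Λ⟩ := hΛ X hD
    exact Λ.mem_algebraicClasses_of_lt (by omega) (low (5 - p) (by omega)) c hc hct

/-- **The pay-off with every input named**: sector (m = 1) ∧ Lefschetz (1,1) on 4- and 5-ball
quotients ∧ KM₀ ∧ bridge ∧ graded commutativity ∧ `LDivision 1` ∧ Hodge models ⟹ the Hodge
conjecture for every `X` carrying a `UnitaryBallQuotientDatum 5 X` (the hard-Lefschetz datum comes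
from KM₀). -/
theorem fiveBallHodge_holds (hstep : MiddleDegreeStep) (hL4 : LefschetzOneOneOnFourBalls)
    (hL5 : LefschetzOneOneOnFiveBalls) (hKM : KMZero) (hbridge : SpecialDivisorBridge)
    (hcomm : ∀ S : SchemeOver ℂ, cupProduct_gradedComm ℂ (ComplexPoints S)) (hdiv : LDivision 1)
    (hA : ∀ (X : SchemeOver ℂ), Nonempty (UnitaryBallQuotientDatum 5 X) → Nonempty (HodgeModel 5 X)) :
    ∀ (X : SchemeOver ℂ), Nonempty (UnitaryBallQuotientDatum 5 X) → HodgeConjectureFor 5 X :=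
  fiveBall_allDegrees (fiveBallCodimTwo_holds hstep hL4 hKM hbridge hcomm hdiv) hL5
    (fun X ⟨D⟩ ↦ let ⟨Λ, _⟩ := hKM 4 X D; ⟨Λ⟩) hA

/-! ## §4 The frame certificate: why there is no `SectorComplement_of`

A composition concluding the crux BY NAME from the stubs above needs one more stub, `Residual`: HC
off (sector ∪ lower band). Given the line's own output it is LITERALLY EQUIVALENT to the crux
(`residual_iff_sectorComplement`) and, like the crux, a corollary of HC (`residual_of_hodgeConjecture`)
— costume in the sense of the crux protocol. `Disproof.hodgeConjecture_iff` (re-proved here as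
`frame_is_summit_off_sector`, not imported: the disprover's file changes every cycle) is the same fact
one level up. -/

/-- The residual stub a concluding skeleton would need: the frame, weakened by the line's cells. -/
def Residual : Prop :=
  (∀ (X : SchemeOver ℂ), Nonempty (UnitaryBallQuotientDatum 5 X) → HodgeConjectureFor 5 X) →
    SevenBallCodimThree → MiddleDegreeStep → _root_.HodgeConjecture

/-- With the residual, the crux follows from the line's output (this is what `SectorComplement_of`
would have been). -/
theorem sectorComplement_of_residual (hR : Residual)
    (h5 : MiddleDegreeStep → ∀ (X : SchemeOver ℂ), Nonempty (UnitaryBallQuotientDatum 5 X) →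
      HodgeConjectureFor 5 X)
    (h73 : MiddleDegreeStep → SevenBallCodimThree) : SectorComplement :=
  fun hM ↦ hR (h5 hM) (h73 hM) hM

/-- … but GIVEN that output the residual is the crux itself: COSTUME certificate. -/
theorem residual_iff_sectorComplement
    (h5 : MiddleDegreeStep → ∀ (X : SchemeOver ℂ), Nonempty (UnitaryBallQuotientDatum 5 X) →
      HodgeConjectureFor 5 X)
    (h73 : MiddleDegreeStep → SevenBallCodimThree) : Residual ↔ SectorComplement :=
  ⟨fun hR ↦ sectorComplement_of_residual hR h5 h73, fun hS _ _ hM ↦ hS hM⟩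

/-- The residual is a corollary of the summit, hence irrefutable short of `¬HC` (as the crux is:
`Disproof.sectorComplement_of_hodgeConjecture`). -/
theorem residual_of_hodgeConjecture (h : _root_.HodgeConjecture) : Residual :=
  fun _ _ _ ↦ h

/-- One level up, the disprover's bookkeeping identity `Disproof.hodgeConjecture_iff`, re-proved (the
datum's `isSmoothProjective` feeds `HodgeConjectureFor (2(m+1)) X` at `p := m + 1`). [folklore] -/
theorem frame_is_summit_off_sector : _root_.HodgeConjecture ↔ MiddleDegreeStep ∧ SectorComplement := by
  refine ⟨fun h ↦ ⟨?_, fun _ ↦ h⟩, fun h ↦ h.2 h.1⟩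
  intro m X _ _ hD _ c hc hH
  obtain ⟨D⟩ := hD
  exact (h D.isSmoothProjective).2 (m + 1) c hc hH

/-! ## §5 The card's Hodge-free content with the ring PINNED to the theta span (for crux 13662)

Triage (r1-1, r1-2 (a), r1-3 + G2-3) asked to pin `R`. Pinned to the THETA span the line reads
`KM ∧ PartnerInThetaFive ∧ DeepShallowFive ∧ (Θ₂ algebraic) ⟹ FiveBallCodimTwo`
(`fiveBallCodimTwo_of_theta`): it does not consume `MiddleDegreeStep` at all, and its partner stub
is `MiddleThetaSpan` at m = 1 on every special divisor transported to `X⁵` — EXPECTED FALSE by the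
route's own rev 7 (ε-negative GL₂-CAP kernel `E(Ỹ) ≠ 0`); the cure named by G2-3,
`RestrictionMissesKernel` (`ν_t^* Hdg⁴_ℚ(X⁵) ⊥ E(Ỹ_t)`), is an unfiled automorphic statement with no
vocabulary (Hecke pieces) in the tree. What is checkable and useful is the NEGATIVE side:
`higherBRFive_of_not_shallow`. -/

variable {p : ℕ} {X : SchemeOver ℂ}

/-- `SC^r(D) ⊆ H^{2r}`: classes supported on the codimension-`r` special cycles (the route's
rendering: `⨆` over totally positive `W` of `E`-rank `r` of `classesSupportedOn`). -/
def SC (D : UnitaryBallQuotientDatum p X) (r : ℕ) : Submodule ℂ (complexBetti X (2 * r)) :=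
  ⨆ (W : Submodule D.E (Fin (p + 1) → D.E)) (_ : IsTotallyPositive (conjRingHom D.E) D.H W)
    (_ : Module.finrank D.E W = r), classesSupportedOn X (D.specialSubvariety W) (2 * r)

/-- `Θ₂(D)` on a datum-5 variety: `SC² ⊔ SC¹·Alg¹ ⊔ Hdg^{1,1}_ℚ·Alg¹` — the three summands of the
route's `MiddleThetaSpan`, resp. of the dropped `∃`-item `HigherBlasiusRogawskiClass` (stmt-13662),
written at `p = 5`. -/
def thetaSpanTwo (D : UnitaryBallQuotientDatum 5 X) : Submodule ℂ (complexBetti X (2 * 2)) :=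
  SC D 2 ⊔
    Submodule.span ℂ {z | ∃ s ∈ SC D 1, ∃ d ∈ algebraicClasses X 1,
      z = cupProduct (two_mul_add_two_mul 1 1) s d} ⊔
    Submodule.span ℂ {z | ∃ a : complexBetti X (2 * 1), IsRationalClass a ∧
      IsOfHodgeType 5 X (2 * 1) 1 1 a ∧ ∃ d ∈ algebraicClasses X 1,
        z = cupProduct (two_mul_add_two_mul 1 1) a d}

/-- `Θ₃(D)`: the DEEP theta classes `SC³ ⊔ Θ₂·Alg¹` (contains the card's `d₁ ∪ d₂ ∪ d₃`, `dᵢ` theta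
divisors, and `SC²·Alg¹`, `SC¹·Alg¹·Alg¹`). -/
def thetaSpanThree (D : UnitaryBallQuotientDatum 5 X) : Submodule ℂ (complexBetti X (2 * 3)) :=
  SC D 3 ⊔
    Submodule.span ℂ {z | ∃ x ∈ thetaSpanTwo D, ∃ d ∈ algebraicClasses X 1,
      z = cupProduct (two_mul_add_two_mul 2 1) x d}

/-- **DEEP ⟹ SHALLOW at p = 5, ring pinned** (the card's `DeepShallow`, Hodge-free): for the KM
hard-Lefschetz datum (`h ∈ SC¹`), every deep theta class is `h ∪` (a shallow one):
`Θ₃ ⊆ L(Θ₂)`. Special-cycle part = "the codimension-3 Kudla–Millson generating series of a compact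
5-ball quotient is cohomologically Eisenstein" (decider: the archimedean theta correspondence for
`(U(5,1), U(3,3))`, Li 1990 / Paul 1998); product part = the anisotropic-divisor products. TWO-SIDED. -/
def DeepShallowFive : Prop :=
  ∀ (X : SchemeOver ℂ) (D : UnitaryBallQuotientDatum 5 X) (Λ : HardLefschetzNFold 5 X),
    Λ.hyperplaneClass ∈ SC D 1 →
      thetaSpanThree D ≤ (thetaSpanTwo D).map (Λ.L 1 (2 * 2) (2 * 3) (by norm_num))

/-- **PARTNER-IN-THETA at p = 5** (the card's `PartnerDeep`, ring pinned): `α ∪ s ∈ Θ₃` for every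
rational Hodge `(2,2)`-class `α` and `s ∈ SC¹`. NOT delivered by the sector (which only makes
`ν^* α` algebraic): it is `MiddleThetaSpan` (m = 1) on every special divisor + heredity — expected
FALSE (route rev 7); recorded as the stub at which the ring version of the line dies. -/
def PartnerInThetaFive : Prop :=
  ∀ (X : SchemeOver ℂ) (D : UnitaryBallQuotientDatum 5 X) (α : complexBetti X (2 * 2)),
    IsRationalClass α → IsOfHodgeType 5 X (2 * 2) 2 2 α →
      ∀ s ∈ SC D 1, cupProduct (two_mul_add_two_mul 2 1) α s ∈ thetaSpanThree D

/-- The ring-pinned line (for the record): it closes the cell WITHOUT the crux hypothesis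
`MiddleDegreeStep`, from KM (`h ∈ SC¹` for some hard-Lefschetz datum), partner-in-theta,
deep–shallow and algebraicity of `Θ₂` (special classes, Lefschetz (1,1), cup products). -/
theorem fiveBallCodimTwo_of_theta
    (hKM : ∀ (X : SchemeOver ℂ) (D : UnitaryBallQuotientDatum 5 X),
      ∃ Λ : HardLefschetzNFold 5 X, Λ.hyperplaneClass ∈ SC D 1)
    (hP : PartnerInThetaFive) (hS : DeepShallowFive)
    (halg : ∀ (X : SchemeOver ℂ) (D : UnitaryBallQuotientDatum 5 X), thetaSpanTwo D ≤ algebraicClasses X 2)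
    (hcomm : ∀ S : SchemeOver ℂ, cupProduct_gradedComm ℂ (ComplexPoints S)) : FiveBallCodimTwo := by
  rintro X ⟨D⟩ c hc hct
  obtain ⟨Λ, hh⟩ := hKM X D
  have hmem : Λ.L 1 (2 * 2) (2 * 3) (by norm_num) c ∈ thetaSpanThree D := by
    rw [L_one_eq_cup (hcomm X) Λ c]
    exact hP X D c hc hct _ hh
  obtain ⟨x, hx, hxc⟩ := Submodule.mem_map.1 (hS X D Λ hh hmem)
  have hinj := (Λ.bijective_L (j := 1) (k := 2 * 2) (by norm_num) (2 * 3) (by norm_num)).1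
  exact halg X D (hinj hxc ▸ hx)

/-- **HIGHER BLASIUS–ROGAWSKI CLASS at p = 5** (the dropped route item stmt-13662 re-rendered over
`Θ₂`): some compact 5-ball quotient carries a rational Hodge `(2,2)`-class outside the theta span. -/
def HigherBRFive : Prop :=
  ∃ (X : SchemeOver ℂ) (D : UnitaryBallQuotientDatum 5 X) (c : complexBetti X (2 * 2)),
    IsRationalClass c ∧ IsOfHodgeType 5 X (2 * 2) 2 2 c ∧ c ∉ thetaSpanTwo D

/-- **The card's bet, made checkable (negative side):** a rational `(3,3)`-class `y` — e.g. a deep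
theta class `d₁ ∪ d₂ ∪ d₃`, `dᵢ` anisotropic theta divisors, or a codimension-3 special class — that
is NOT `h ∪` (a shallow theta class) hands crux 13662 the NAMED higher Blasius–Rogawski class
`h⁻¹ y` (hard Lefschetz descent of rationality and type, `exists_hdg_preimage`). -/
theorem higherBRFive_of_not_shallow (D : UnitaryBallQuotientDatum 5 X) (Λ : HardLefschetzNFold 5 X)
    {y : complexBetti X (2 * 3)} (hy : IsRationalClass y) (hyt : IsOfHodgeType 5 X (2 * 3) 3 3 y)
    (hnot : y ∉ (thetaSpanTwo D).map (Λ.L 1 (2 * 2) (2 * 3) (by norm_num))) : HigherBRFive := by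
  obtain ⟨x, hx, hxt, rfl⟩ :=
    Λ.exists_hdg_preimage (j := 1) (k := 2 * 2) (by norm_num) (2 * 3) (by norm_num) 2 2 y hy hyt
  exact ⟨X, D, x, hx, hxt, fun hmem ↦ hnot (Submodule.mem_map_of_mem hmem)⟩

/-- Conversely no higher BR class ⟹ every rational `(3,3)`-class of a 5-ball quotient with a
hard-Lefschetz datum is `h ∪` (theta): deep–shallow then holds on the rational Hodge classes of
`Θ₃` for free. So at p = 5 the card's dichotomy is exactly `HigherBRFive ∨ (Hdg³³_ℚ ⊆ L Θ₂)`. -/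
theorem shallow_of_not_higherBR (h : ¬ HigherBRFive) (D : UnitaryBallQuotientDatum 5 X)
    (Λ : HardLefschetzNFold 5 X) {y : complexBetti X (2 * 3)} (hy : IsRationalClass y)
    (hyt : IsOfHodgeType 5 X (2 * 3) 3 3 y) :
    y ∈ (thetaSpanTwo D).map (Λ.L 1 (2 * 2) (2 * 3) (by norm_num)) := by
  by_contra hnot
  exact h (higherBRFive_of_not_shallow D Λ hy hyt hnot)

end Summit.HodgeConjecture.HodgeConjecture.Cruxes.SectorComplement.DeepCycleShadows

end
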